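import Mathlib
import Summits.ResolutionOfSingularities.ResolutionOfSingularities.Theorems.HomologicalConductorPersistenceCyclicQuotientCharFree
import Summits.ResolutionOfSingularities.ResolutionOfSingularities.Theorems.HomologicalConductorPersistenceGradedTransferCeiling
import HarnessLib

/-!
# Rung S-2 `PersistenceSurface` (stmt-ResolutionOfSingularities-19970) — AUSLANDER'S LAW for the cyclic quotient
# surface `k[u,v]^{(n; 1,q)}` in EVERY CHARACTERISTIC, and the EXACT monomial criterion of the engines
# (cell C2 / K-PCC F5–F6; res-L1-w44b-stub-1 gen 6)

Route `ResolutionOfSingularities/HomologicalConductor`, chain W4.4b (cell res-hironaka).  `[OURS · L1 w44b]` replaces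
the role of no printed item; NOT a statement of the manuscript under review (Hironaka 2017), nothing here is
attributed to its author; folklore algebra, AI-written (weaker than expert review).

## Content

`U ⊆ k[u,v]` the degree-`0` subalgebra for the `ZMod n`-grading `deg uⁱvʲ = i + qj`, `gcd(q,n) = 1`, `k` ANY field
(`p = char k ∣ n` allowed: `U` is the ring of invariants of the — possibly non-reduced — group scheme `μ_n`, the
same monomial algebra in every characteristic).

* **`mem_cohomologyAnnihilatorOfDegree_three_iff`** — AUSLANDER'S LAW at level `ca³`, every characteristic:
  `x ∈ ca³(U) ⟺ ∀ a, x = ∑ⱼ bⱼ b′ⱼ` with `deg bⱼ = a`, `deg b′ⱼ = −a` (`ca³(U) = ⋂ₐ V_a·V_{−a}`); floor =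
  `…CyclicQuotientCharFree.mem_cohomologyAnnihilatorOfDegree_three_of_decomp`, ceiling =
  `…PersistenceGradedTransfer.exists_graded_decomposition_of_mem_cohomologyAnnihilatorOfDegree_three`.
  Stub-4's `…CyclicQuotientSurface.mem_cohomologyAnnihilatorOfDegree_three_iff_cyclicQuotient` minus the primitive
  root of unity, `n ∈ kˣ`, `[IsNoetherianRing U]` and `[Module.Finite U k[u,v]]`.
* `exists_divisor_of_coeff_sum_mul_ne_zero` — if `∑ⱼ bⱼ b′ⱼ` has a nonzero `uⁱvʲ`-coefficient and every `bⱼ` has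
  degree `a`, then some divisor `u^{i₁}v^{j₁}` of `uⁱvʲ` has degree `a`.
* **`monomial_mem_cohomologyAnnihilatorOfDegree_three_iff`** — THE ENGINES' CRITERION IS EXACT: an invariant
  monomial `uⁱvʲ` lies in `ca³(U)` IFF its divisors realise every residue mod `n`
  (`kstar.cyclic_ca_contains`, `cycca.py`; both verdicts «∈» and «∉ ca³» are now kernel statements, all `p`).

References (mechanism only): S. B. Iyengar, R. Takahashi, IMRN 2016, arXiv:1404.1476 [`IyengarTakahashi2014`];
M. Auslander, Trans. AMS 293 (1986); folklore.
-/

noncomputable section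

-- single-problem summit: the doubled namespace component `ResolutionOfSingularities` is forced
set_option linter.dupNamespace false

namespace Summit.ResolutionOfSingularities.ResolutionOfSingularities.Theorems.HomologicalConductor.PersistenceCyclicQuotientCharFree

open Finset CategoryTheory MvPolynomial Literature.RingTheory.CohomologyAnnihilator
open Summit.ResolutionOfSingularities.ResolutionOfSingularities.Theorems.HomologicalConductor.PersistenceGradedTransfer
open Summit.ResolutionOfSingularities.ResolutionOfSingularities.Theorems.HomologicalConductor.PersistenceCyclicQuotientSurface

universe u

variable {k : Type u} [Field k] {n : ℕ} [NeZero n]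

/-- **AUSLANDER'S LAW for `1/n(1,q)` at level `ca³`, EVERY characteristic.**  For `x ∈ U = k[u,v]^{(n;1,q)}`
(`gcd(q,n) = 1`, `k` any field): `x ∈ ca³(U)` iff for every residue `a` mod `n`, `x = ∑ⱼ bⱼ b′ⱼ` in `k[u,v]` with
`deg bⱼ = a` and `deg b′ⱼ = −a`.  No root of unity, no `n ∈ kˣ`, no instance hypotheses. [OURS · L1 w44b] -/
theorem mem_cohomologyAnnihilatorOfDegree_three_iff {q : ℕ} (hq : q.Coprime n)
    (U : Subalgebra k (MvPolynomial (Fin 2) k))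
    (hU : ∀ p, p ∈ U ↔ weightedHomogeneousComponent (![1, (q : ZMod n)]) 0 p = p) (x : U) :
    x ∈ cohomologyAnnihilatorOfDegree U 3 ↔
      ∀ a : ZMod n, ∃ (m : ℕ) (b b' : Fin m → MvPolynomial (Fin 2) k),
        (∀ j, IsWeightedHomogeneous (![1, (q : ZMod n)]) (b j) a) ∧
        (∀ j, IsWeightedHomogeneous (![1, (q : ZMod n)]) (b' j) (-a)) ∧
          ∑ j, b j * b' j = (x : MvPolynomial (Fin 2) k) := by
  obtain ⟨e, ρ, he, he_sum, he_proj, he_mul, he_one, he_zero, hρ⟩ := exists_grading (k := k) (n := n) q U hU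
  have hinj : Function.Injective (algebraMap U (MvPolynomial (Fin 2) k)) := Subtype.val_injective
  haveI : IsNoetherianRing U := isNoetherianRing_of_retract ρ fun u => hinj (by
    rw [hρ, he]; exact (hU u).mp u.2)
  have hV3 : cohomologyAnnihilatorOfDegree (MvPolynomial (Fin 2) k) 3 = ⊤ :=
    cohomologyAnnihilatorOfDegree_mvPolynomial_eq_top k 2
  have hbig : ∀ (y : ZMod n) (P : Ideal (MvPolynomial (Fin 2) k)), P.IsPrime → P.height = 1 →
      ∃ m, e y m = m ∧ m ∉ P := fun y P hP hP1 => by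
    obtain ⟨m, hm, hmP⟩ := hbig_weighted (k := k) hq y P hP hP1
    exact ⟨m, by rw [he]; exact hm, hmP⟩
  -- every piece is nonzero: `u ^ a.val`
  have hne : ∀ a : ZMod n, ∃ m : MvPolynomial (Fin 2) k, e a m = m ∧ m ≠ 0 := fun a => by
    refine ⟨X 0 ^ a.val, ?_, pow_ne_zero _ (X_ne_zero 0)⟩
    rw [he]
    apply weightedHomogeneousComponent_eq_self
    have h := (isWeightedHomogeneous_X k (![1, (q : ZMod n)]) (0 : Fin 2)).pow a.val
    rwa [Matrix.cons_val_zero, nsmul_eq_mul, mul_one, ZMod.natCast_zmod_val] at h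
  -- degree conditions: `e a b = b ↔ IsWeightedHomogeneous b a`
  have hdeg : ∀ (a : ZMod n) (b : MvPolynomial (Fin 2) k),
      e a b = b ↔ IsWeightedHomogeneous (![1, (q : ZMod n)]) b a := fun a b => by
    rw [he]
    exact ⟨fun h => by rw [← h]; exact weightedHomogeneousComponent_isWeightedHomogeneous a b,
      fun h => weightedHomogeneousComponent_eq_self h⟩
  rw [mem_cohomologyAnnihilatorOfDegree_three_iff_of_graded e he_sum he_proj he_mul he_one he_zero hinj hbig ρ hρ hV3
    hne x]
  refine forall_congr' fun a => ⟨fun ⟨m, b, b', hb, hb', hsum⟩ => ⟨m, b, b', fun j => (hdeg _ _).mp (hb j),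
    fun j => (hdeg _ _).mp (hb' j), hsum⟩, fun ⟨m, b, b', hb, hb', hsum⟩ => ⟨m, b, b', fun j => (hdeg _ _).mpr (hb j),
    fun j => (hdeg _ _).mpr (hb' j), hsum⟩⟩

omit [NeZero n] in
/-- **Coefficient extraction.**  If `∑ⱼ bⱼ b′ⱼ` has a nonzero coefficient at `uⁱvʲ` and every `bⱼ` is weighted
homogeneous of degree `a` (weights `(1,q)` mod `n`), then some divisor `u^{i₁}v^{j₁}` (`i₁ ≤ i`, `j₁ ≤ j`) of `uⁱvʲ`
has degree `i₁ + q j₁ ≡ a`. [folklore] -/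
theorem exists_divisor_of_coeff_sum_mul_ne_zero (q : ℕ) {m : ℕ} (b b' : Fin m → MvPolynomial (Fin 2) k)
    (a : ZMod n) (hb : ∀ j, IsWeightedHomogeneous (![1, (q : ZMod n)]) (b j) a) (i j : ℕ)
    (h : coeff (Finsupp.single 0 i + Finsupp.single 1 j) (∑ l, b l * b' l) ≠ 0) :
    ∃ i₁ j₁ : ℕ, i₁ ≤ i ∧ j₁ ≤ j ∧ ((i₁ + q * j₁ : ℕ) : ZMod n) = a := by
  classical
  rw [coeff_sum] at h
  obtain ⟨l, -, hl⟩ := Finset.exists_ne_zero_of_sum_ne_zero h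
  rw [coeff_mul] at hl
  obtain ⟨d, hd, hdl⟩ := Finset.exists_ne_zero_of_sum_ne_zero hl
  rw [Finset.HasAntidiagonal.mem_antidiagonal] at hd
  have hd1 : coeff d.1 (b l) ≠ 0 := fun h0 => hdl (by rw [h0, zero_mul])
  have hwt : Finsupp.weight (![1, (q : ZMod n)]) d.1 = a := hb l hd1
  refine ⟨d.1 0, d.1 1, ?_, ?_, ?_⟩
  · have := congrArg (fun f : Fin 2 →₀ ℕ => f 0) hd
    simp only [Finsupp.add_apply, Finsupp.single_apply, if_true, Fin.one_eq_zero_iff, OfNat.ofNat_ne_one,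
      if_false, add_zero] at this
    omega
  · have := congrArg (fun f : Fin 2 →₀ ℕ => f 1) hd
    simp only [Finsupp.add_apply, Finsupp.single_apply, Fin.zero_eq_one_iff, OfNat.ofNat_ne_one, if_false,
      if_true, zero_add] at this
    omega
  · -- the monomial `u^{d₁ 0} v^{d₁ 1} = monomial d.1 1` has degree `d₁ 0 + q d₁ 1` and degree `weight d.1 = a`
    have hd1eq : Finsupp.single 0 (d.1 0) + Finsupp.single 1 (d.1 1) = d.1 := by
      ext l
      fin_cases l <;> simp
    have hmon : (X 0 ^ (d.1 0) * X 1 ^ (d.1 1) : MvPolynomial (Fin 2) k) = monomial d.1 1 := by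
      rw [X_pow_eq_monomial, X_pow_eq_monomial, monomial_mul, mul_one, hd1eq]
    have h1 := isWeightedHomogeneous_X_pow_mul_X_pow (k := k) (n := n) q (d.1 0) (d.1 1)
    rw [hmon] at h1
    have h2 : coeff d.1 (monomial d.1 (1 : k)) ≠ 0 := by rw [coeff_monomial, if_pos rfl]; exact one_ne_zero
    rw [← hwt]
    exact (h1 h2).symm

/-- **THE ENGINES' CRITERION IS EXACT (every characteristic).**  For `U = k[u,v]^{(n;1,q)}` (`gcd(q,n) = 1`, `k` any
field) and an invariant monomial `uⁱvʲ ∈ U`: `uⁱvʲ ∈ ca³(U)` IFF for every residue `a` mod `n` some divisor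
`u^{i₁}v^{j₁}` (`i₁ ≤ i`, `j₁ ≤ j`) has degree `i₁ + q j₁ ≡ a` — the test of `kstar.cyclic_ca_contains` / `cycca.py`,
both verdicts certified. [OURS · L1 w44b] -/
theorem monomial_mem_cohomologyAnnihilatorOfDegree_three_iff {q : ℕ} (hq : q.Coprime n)
    (U : Subalgebra k (MvPolynomial (Fin 2) k))
    (hU : ∀ p, p ∈ U ↔ weightedHomogeneousComponent (![1, (q : ZMod n)]) 0 p = p) (i j : ℕ)
    (hmem : (X 0 ^ i * X 1 ^ j : MvPolynomial (Fin 2) k) ∈ U) :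
    (⟨X 0 ^ i * X 1 ^ j, hmem⟩ : U) ∈ cohomologyAnnihilatorOfDegree U 3 ↔
      ∀ a : ZMod n, ∃ i₁ j₁ : ℕ, i₁ ≤ i ∧ j₁ ≤ j ∧ ((i₁ + q * j₁ : ℕ) : ZMod n) = a := by
  classical
  refine ⟨fun h a => ?_, monomial_mem_cohomologyAnnihilatorOfDegree_three hq U hU i j hmem⟩
  obtain ⟨m, b, b', hb, -, hsum⟩ := (mem_cohomologyAnnihilatorOfDegree_three_iff hq U hU _).mp h a
  refine exists_divisor_of_coeff_sum_mul_ne_zero q b b' a hb i j ?_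
  rw [hsum]
  change coeff (Finsupp.single 0 i + Finsupp.single 1 j) (X 0 ^ i * X 1 ^ j : MvPolynomial (Fin 2) k) ≠ 0
  rw [X_pow_eq_monomial, X_pow_eq_monomial, monomial_mul, mul_one, coeff_monomial, if_pos rfl]
  exact one_ne_zero

end Summit.ResolutionOfSingularities.ResolutionOfSingularities.Theorems.HomologicalConductor.PersistenceCyclicQuotientCharFree

end
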